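import Literature.Analysis.FluidPDE.TorusNSGevreyBootstrap
import Summits.AnomalousDissipation.AnomalousDissipation.Theorems.BaireTransferDenseLoudDesignerForcesErgodicH2Smoothing

/-!
# An NS phase is uniformly Gevrey after time one
# (tools stub E12 `stub_phaseGevreyTools` of block N, line `ergodic-budget-selection-closing`,
# crux `BaireTransfer.DenseLoudDesignerForces`, stmt-AnomalousDissipation-1143)

Summit-side glue reading the Foias–Temam Gevrey smoothing theorem
`Torus.IsClassicalNSSolutionOn.gevrey_of_gradNormSq_le`
(`Literature/Analysis/FluidPDE/TorusNSGevreyBootstrap.lean`; Foias–Temam, J. Funct. Anal. 87 (1989),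
Thm 1.1) along the classical trajectories of an NS phase `(K, φ)` (`IsNSPhase`, `…ErgodicLine.lean`)
of the designer force `f_c = force S c = realTrigPoly S (k ↦ P_k ĉ_k)` at viscosity `ν > 0`: there
are `σ > 0` and `C` with `∑_{k ∈ S'} e^{2σ|k|} ‖𝓕(rep (φ_t x))(k)‖² ≤ C` for every `x ∈ K`, every
`t ≥ 1` and every finite `S' ⊆ ℤ³`.  Ingredients: the uniform enstrophy bound along the phase
(`IsNSPhase.exists_forall_gradNormSq_le`, `…ErgodicH2Smoothing.lean`), zero-mean slices
(`hasZeroMean_of_rep_ae_eq`), restriction of the global trajectory to the window `[t − 1, t]`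
(`Torus.IsClassicalNSSolutionOn.mono`), the Gevrey smoothing theorem on that window — its force
hypothesis `∑_{|k|≤R} e^{2|k|} |k|² ‖f̂(k)‖² ≤ F` holds with the finite constant
`F = ∑_{k ∈ S ∪ −S} e^{2|k|} |k|² ‖f̂_c(k)‖²`, the trigonometric polynomial being band-limited to
`S ∪ −S` (`Torus.mFourierCoeff_realTrigPoly_eq_zero_of_not_mem`) — and invariance of Fourier
coefficients under a.e.-equality (`Torus.mFourierCoeff_congr_ae`) to pass from the smooth
representative `u t` to `rep (φ_t x)`.  In particular the invariant core `K_∞ ⊆ φ₁(K)` of the phase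
is uniformly Gevrey — the input of the time-regularity and compactness steps of the smooth model
(block N).

Reference: C. Foias, R. Temam, *Gevrey class regularity for the solutions of the Navier–Stokes
equations*, J. Funct. Anal. 87 (1989) 359–369, Thm 1.1.
-/

-- `Summit.<Summit>.<Problem>` is the tree's mandated summit-side namespace (CONVENTIONS §2); for this
-- single-conjunct summit the two coincide, so the duplicate is deliberate.
set_option linter.dupNamespace false

noncomputable section

open scoped BigOperators Topology ENNReal InnerProductSpace
open Filter Set Function MeasureTheory

namespace Summit.AnomalousDissipation.AnomalousDissipation.Theorems.DenseLoudDesignerForces.Ergodic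

open Literature.Analysis.FunctionSpaces Literature.Analysis.FunctionSpaces.Torus
open Literature.Analysis.FluidPDE Literature.Analysis.FluidPDE.Torus
open Summit.AnomalousDissipation.AnomalousDissipation.Theses.BaireTransfer
open Summit.AnomalousDissipation.AnomalousDissipation.Theorems.DenseLoudDesignerForces.Negative

/-- The designer force `f_c = realTrigPoly S (k ↦ P_k ĉ_k)` is band-limited to `S ∪ −S`, so its
Gevrey level `∑_{|k| ≤ R} e^{2τ|k|} |k|² ‖f̂_c(k)‖²` over any frequency ball is at most the finite sum
of the same non-negative terms over `S ∪ −S` (`Torus.mFourierCoeff_realTrigPoly_eq_zero_of_not_mem`).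
[folklore] -/
theorem force_gevreyLevel_freqBall_le (S : Finset (Fin 3 → ℤ)) (c : ↥S → (EuclideanSpace ℂ (Fin 3)))
    (τ : ℝ) (R : ℕ) :
    ∑ k ∈ freqBall R, Real.exp (τ * Real.sqrt (freqNormSq k)) ^ 2 *
        (freqNormSq k * ‖UnitAddTorus.mFourierCoeff (EuclideanSpace.complexify ∘ force S c) k‖ ^ 2) ≤
      ∑ k ∈ S ∪ S.image (fun k => -k), Real.exp (τ * Real.sqrt (freqNormSq k)) ^ 2 *
        (freqNormSq k * ‖UnitAddTorus.mFourierCoeff (EuclideanSpace.complexify ∘ force S c) k‖ ^ 2) := by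
  classical
  set g : (Fin 3 → ℤ) → ℝ := fun k => Real.exp (τ * Real.sqrt (freqNormSq k)) ^ 2 *
    (freqNormSq k * ‖UnitAddTorus.mFourierCoeff (EuclideanSpace.complexify ∘ force S c) k‖ ^ 2) with hg
  have hg0 : ∀ k, 0 ≤ g k := fun k =>
    mul_nonneg (sq_nonneg _) (mul_nonneg (freqNormSq_nonneg k) (sq_nonneg _))
  have hzero : ∀ k, k ∉ S ∪ S.image (fun k => -k) → g k = 0 := fun k hk => by
    have hk1 : k ∉ S := fun h1 => hk (Finset.mem_union_left _ h1)
    have hk2 : -k ∉ S := fun h2 =>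
      hk (Finset.mem_union_right _ (Finset.mem_image.2 ⟨-k, h2, neg_neg k⟩))
    have h0 : UnitAddTorus.mFourierCoeff (EuclideanSpace.complexify ∘ force S c) k = 0 :=
      mFourierCoeff_realTrigPoly_eq_zero_of_not_mem _ hk1 hk2
    simp only [hg, h0, norm_zero]
    ring
  calc ∑ k ∈ freqBall R, g k = ∑ k ∈ freqBall R ∩ (S ∪ S.image (fun k => -k)), g k :=
        (Finset.sum_subset Finset.inter_subset_left fun k hkB hknot =>
          hzero k fun hkT => hknot (Finset.mem_inter.2 ⟨hkB, hkT⟩)).symm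
    _ ≤ ∑ k ∈ S ∪ S.image (fun k => -k), g k :=
        Finset.sum_le_sum_of_subset_of_nonneg Finset.inter_subset_right fun k _ _ => hg0 k

/-- **Tools stub E12 (`stub_phaseGevreyTools`): an NS phase is uniformly Gevrey after time one.**
For an NS phase `(K, φ)` of the designer force `f_c` at viscosity `ν > 0` there are `σ > 0` and `C`
such that every state `φ t x`, `x ∈ K`, `t ≥ 1`, has a Gevrey-class representative:
`∑_{k ∈ S'} e^{2σ|k|} ‖𝓕(rep (φ t x))(k)‖² ≤ C` for every finite `S' ⊆ ℤ³`.  Proof: the enstrophy of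
every trajectory is bounded by some `E₁` uniformly on `K × [0, ∞)`
(`IsNSPhase.exists_forall_gradNormSq_le`); along the classical trajectory `(u, p)` of `x`
(`IsNSPhase.trajectory`) the slices are mean-zero (`hasZeroMean_of_rep_ae_eq`); the Foias–Temam
theorem `Torus.IsClassicalNSSolutionOn.gevrey_of_gradNormSq_le` with window length `1` and the
Gevrey level of the band-limited force (`force_gevreyLevel_freqBall_le`) on the window `[t − 1, t]`
bounds the Gevrey sums of `u t`, and `rep (φ t x) =ᵐ u t` has the same Fourier coefficients
(`Torus.mFourierCoeff_congr_ae`). [cite: FoiasTemam1989, Thm 1.1] -/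
theorem stub_phaseGevreyTools {S : Finset (Fin 3 → ℤ)} {c : ↥S → (EuclideanSpace ℂ (Fin 3))} {ν : ℝ} {K : Set Hsp}
    {φ : ℝ → Hsp → Hsp} (hν : 0 < ν) (hK : IsNSPhase ν (force S c) K φ) :
    ∃ σ : ℝ, 0 < σ ∧ ∃ C : ℝ, ∀ x ∈ K, ∀ t : ℝ, 1 ≤ t → ∀ S' : Finset (Fin 3 → ℤ),
      ∑ k ∈ S', Real.exp (2 * σ * Real.sqrt (freqNormSq k)) *
        ‖UnitAddTorus.mFourierCoeff (EuclideanSpace.complexify ∘ rep (φ t x)) k‖ ^ 2 ≤ C := by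
  classical
  obtain ⟨E₁, hE₁⟩ := hK.exists_forall_gradNormSq_le
  obtain ⟨σ, hσ, C, hC⟩ := IsClassicalNSSolutionOn.gevrey_of_gradNormSq_le (d := Fin 3)
    (Fintype.card_fin 3).le hν E₁ 1
    (∑ k ∈ S ∪ S.image (fun k => -k), Real.exp (1 * Real.sqrt (freqNormSq k)) ^ 2 *
      (freqNormSq k * ‖UnitAddTorus.mFourierCoeff (EuclideanSpace.complexify ∘ force S c) k‖ ^ 2))
    one_pos
  refine ⟨σ, hσ, C, fun x hx t ht S' => ?_⟩
  obtain ⟨u, p, hsol, hrep⟩ := hK.trajectory x hx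
  have ht0 : 0 ≤ t - 1 := sub_nonneg.2 ht
  have hsub : Icc (t - 1) (t - 1 + 1) ⊆ Ici 0 := fun s hs => mem_Ici.2 (ht0.trans hs.1)
  have hlt : t - 1 < t - 1 + 1 := by linarith
  have hsol' : IsClassicalNSSolutionOn (Icc (t - 1) (t - 1 + 1)) ν (fun _ => force S c) u p :=
    hsol.mono hsub (uniqueDiffOn_Icc hlt)
  have h := hC hsol' (fun s hs => hasZeroMean_of_rep_ae_eq (φ s x) (hrep s (hsub hs)))
    (fun s hs => hE₁ x hx u p hsol hrep s (hsub hs))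
    (fun _ _ R => force_gevreyLevel_freqBall_le S c 1 R) S'
  rw [sub_add_cancel] at h
  have heq : ∀ k, UnitAddTorus.mFourierCoeff (EuclideanSpace.complexify ∘ rep (φ t x)) k =
      UnitAddTorus.mFourierCoeff (EuclideanSpace.complexify ∘ u t) k := fun k =>
    mFourierCoeff_congr_ae ((hrep t (ht0.trans (sub_one_lt t).le)).fun_comp EuclideanSpace.complexify) k
  simp only [heq]
  exact h

end Summit.AnomalousDissipation.AnomalousDissipation.Theorems.DenseLoudDesignerForces.Ergodic

end
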